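import Literature.Computability.QuantumComplexity.MSubspaceSignReadoutRelaxed
import Literature.Computability.QuantumComplexity.MSubspaceSignReadoutSampler
import HarnessLib

/-!
# The M-subspace sign readout, IV: the vote of the relaxed machine (SAFE law, one certified run)

Proof-only analysis of the sampler rounds of `MSubspaceSignReadoutRelaxed.lean` (`MMReadout.negCountN`,
`voteN`, `roundsR`) on ONE certified list of rows. Fix `n`, circuit codes `cf`, `cg` computing `f`, `g`,
rows `L` with reduced form `S = rrun n L` such that `g` is affine on every coset of `V = spanV n L`, and
write `p = #pivs(S) = dim V`. The recorded bit of a round on the coin block `β = (z, w) ∈ {0,1}^{2n}` has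
sign `R(β) = (-1)^{f x + g z + x·z}`, `x = x(z,w)` the sampled partner (`signOf_rbit`). This file proves:

* `sum_signOf_rbit_blocks`: `Σ_β R(β) = 2^p · Σ_z Σ_{x matching z} (-1)^{f x}(-1)^{g z}(-1)^{x·z}` (the
  sampler is uniform on matching pairs, `sum_sampler_eq`), so that under the DUAL-VALUE IDENTITY
  `Σ_z Σ_{x matching z} … = √(2^{3n}) Φ(f,g)` (an input here, cf. the stub `stub_dualValue` of the line
  `polar-radical-seeds`) the mean of a round is `μ = 2^p √(2^{3n}) Φ / 4ⁿ`, `μ² = Φ² 4^p / 2ⁿ`;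
  `sum_signOf_rbit_blocks_sq`: the second moment is `1` per block;
* `sum_signOf_rounds`, `voteN_eq_decide`: `N − 2 · negCountN N … y 0 = Σ_{r<N} R(block r of y)`, so the vote
  reads the sign of the block sum; a WRONG vote (against the sign of `μ`) forces a deviation
  `|Σ_r R − N μ| ≥ N |μ|` (`mul_abs_le_abs_sub_of_wrong`);
* `cnt_voteN_wrong_mul_le`: by Chebyshev over the `N` independent blocks
  (`CubicDequant.card_deviation_mul_sq_le'`), the coin strings of length `2nN` with a wrong vote number at
  most `4^{nN} / (N μ²)`;
* `seventytwo_le`: with the RELAXED RANK CERTIFICATE `n ≤ 2p + c' ⌊log₂(n+2)⌋` and `|Φ| ≥ 3/5`,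
  `N μ² ≥ 72` for `N = roundsR c' n = 200 (n+2)^{c'}` (`2^{⌊log₂(n+2)⌋} ≤ n + 2`, `two_pow_le_of_rank`), whence
  the SAFE LAW OF ONE RUN `cnt_voteN_wrong_le`: at most `4^{nN}/72` coin strings vote against the sign of `Φ`;
* coin bookkeeping: the vote reads only the first `2nN` coins after its offset (`voteN_append`,
  `voteN_shift`).

## References

* S. Arora, B. Barak, *Computational Complexity: A Modern Approach*, CUP 2009, Lemma A.12 (Chebyshev),
  §7.4.1 (error reduction by repetition). [AroraBarak2009]
* C. Carlet, *Boolean Functions for Cryptography and Coding Theory*, CUP 2020, Prop. 54, §6.1.5. [Carlet2020]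
* S. Aaronson, A. Ambainis, *Forrelation*, SIAM J. Comput. 47 (2018), §1.1.1. [AaronsonAmbainis2018]
-/

noncomputable section

namespace Literature.Computability.QuantumComplexity

namespace MMReadout

open Finset Literature.Computability.Complexity Literature.Computability.Complexity.F2Elim
open ForrCode QuadSampler CubicDequant
open BuzetChailloux (bxor zeroVec)

variable {n : ℕ}

/-! ### The sum and the second moment of a round over one coin block -/

section OneRun

variable {cf cg : PCirc} {f g : (Fin n → Bool) → Bool} {L : List (List Bool)}
  (hf : ∀ v, evalP cf v = f (toInput n v)) (hg : ∀ v, evalP cg v = g (toInput n v))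
  (hM : ∀ u ∈ spanV n L, ∀ v ∈ spanV n L, ∀ y,
    (g y ^^ g (bxor y u) ^^ g (bxor y v) ^^ g (bxor y (bxor u v))) = false)

include hf hg hM in
/-- **The block sum of the round signs**: summed over all coin blocks `β = (z,w)`, the sign of the recorded
bit is `2^{#pivs}` times the matched double sum `Σ_z Σ_{x matching z} (-1)^{f x}(-1)^{g z}(-1)^{x·z}`.
[cite: Carlet2020, §6.1.5] -/
theorem sum_signOf_rbit_blocks :
    ∑ β : Fin (2 * n) → Bool, signOf (rbit n cf cg (rrun n L) (List.ofFn (hOf β)) (List.ofFn (wOf β))) =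
      (2 : ℝ) ^ (pivs n (rrun n L)).card *
        ∑ z : Fin n → Bool, ∑ x ∈ matchSet g (spanV n L) z, signOf (f x) * signOf (g z) * twist x z := by
  rw [sum_block_eq (fun h w => signOf (rbit n cf cg (rrun n L) (List.ofFn h) (List.ofFn w)))]
  simp_rw [signOf_rbit hf hg]
  exact sum_sampler_eq hg hM (fun z x => signOf (f x) * signOf (g z) * twist x z)

/-- The second moment of a round sign is `1` per block: `Σ_β R(β)² = 4ⁿ`. [folklore] -/
theorem sum_signOf_rbit_blocks_sq (S : List Row) :
    ∑ β : Fin (2 * n) → Bool, signOf (rbit n cf cg S (List.ofFn (hOf β)) (List.ofFn (wOf β))) ^ 2 =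
      (2 : ℝ) ^ (2 * n) := by
  have h1 : ∀ b : Bool, signOf b ^ 2 = 1 := fun b => by cases b <;> simp [signOf]
  simp_rw [h1]
  rw [sum_const, card_univ, Fintype.card_fun, Fintype.card_bool, Fintype.card_fin, nsmul_eq_mul, mul_one]
  push_cast; rfl

end OneRun

/-! ### The vote counts the signs of the rounds -/

/-- The coin slice `z` of round `r` (offset `2rn`) is the first half of block `r` of the coins (blocks of
`2n`). [folklore] -/
theorem coinVec_round_z (y : List Bool) (n : ℕ) {N : ℕ} (r : Fin N) :
    coinVec y n (0 + 2 * r * n) = List.ofFn (hOf (BravyiGosset.blocksOf (2 * n) y N r)) := by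
  rw [coinVec_eq_ofFn]
  congr 1; funext i
  simp only [hOf, BravyiGosset.blocksOf]
  congr 1; ring

/-- The coin slice `w` of round `r` (offset `(2r+1)n`) is the second half of block `r`. [folklore] -/
theorem coinVec_round_w (y : List Bool) (n : ℕ) {N : ℕ} (r : Fin N) :
    coinVec y n (0 + (2 * r + 1) * n) = List.ofFn (wOf (BravyiGosset.blocksOf (2 * n) y N r)) := by
  rw [coinVec_eq_ofFn]
  congr 1; funext i
  simp only [wOf, BravyiGosset.blocksOf]
  congr 1; ring

/-- A filter length over `List.range` is a `Fin` sum of indicators. [folklore] -/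
theorem length_filter_range_eq_sum (p : ℕ → Bool) (N : ℕ) :
    (((List.range N).filter p).length : ℝ) = ∑ r : Fin N, if p r then (1 : ℝ) else 0 := by
  rw [F2Elim.length_filter_range_eq_card, Finset.card_filter]
  push_cast
  rfl

/-- **The vote counts signs**: `N − 2 · #negative rounds = Σ_r R(block r)` for the `N` rounds read at
offset `0`. [cite: AroraBarak2009, §7.4.1] -/
theorem sum_signOf_rounds (N n : ℕ) (cf cg : PCirc) (S : List Row) (y : List Bool) :
    ∑ r : Fin N, signOf (rbit n cf cg S (List.ofFn (hOf (BravyiGosset.blocksOf (2 * n) y N r)))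
        (List.ofFn (wOf (BravyiGosset.blocksOf (2 * n) y N r)))) =
      (N : ℝ) - 2 * negCountN N n cf cg S y 0 := by
  rw [negCountN, length_filter_range_eq_sum, mul_sum]
  have hN : (N : ℝ) = ∑ _r : Fin N, (1 : ℝ) := by simp
  rw [hN, ← sum_sub_distrib]
  refine sum_congr rfl fun r _ => ?_
  rw [← coinVec_round_z y n r, ← coinVec_round_w y n r]
  cases rbit n cf cg S (coinVec y n (0 + 2 * r * n)) (coinVec y n (0 + (2 * r + 1) * n)) <;> norm_num [signOf]

/-- **The vote reads the sign of the block sum**: `voteN … y 0 = true` iff `Σ_r R(block r) > 0`.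
[cite: AroraBarak2009, §7.4.1] -/
theorem voteN_eq_decide (N n : ℕ) (cf cg : PCirc) (S : List Row) (y : List Bool) :
    voteN N n cf cg S y 0 = decide (0 < ∑ r : Fin N, signOf (rbit n cf cg S
        (List.ofFn (hOf (BravyiGosset.blocksOf (2 * n) y N r))) (List.ofFn (wOf (BravyiGosset.blocksOf (2 * n) y N r))))) := by
  rw [sum_signOf_rounds, voteN]
  by_cases h : 2 * negCountN N n cf cg S y 0 < N
  · rw [decide_eq_true h, decide_eq_true]
    have : (2 * negCountN N n cf cg S y 0 : ℝ) < N := by exact_mod_cast h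
    linarith
  · rw [decide_eq_false h, decide_eq_false]
    have : (N : ℝ) ≤ 2 * negCountN N n cf cg S y 0 := by exact_mod_cast (not_lt.1 h)
    linarith

/-- **A wrong vote is a large deviation**: if the sign read (`s > 0`) is the opposite of the sign of the
mean `μ ≠ 0`, then `|s − N μ| ≥ N |μ|`. [cite: AroraBarak2009, Lemma A.12] -/
theorem mul_abs_le_abs_sub_of_wrong {N s μ : ℝ} (hN : 0 ≤ N) (hμ : μ ≠ 0) (h : decide (0 < s) = decide (μ < 0)) :
    N * |μ| ≤ |s - N * μ| := by
  rcases lt_or_gt_of_ne hμ with hneg | hpos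
  · rw [decide_eq_true hneg, decide_eq_true_iff] at h
    rw [abs_of_neg hneg, abs_of_pos (by nlinarith)]
    nlinarith
  · rw [decide_eq_false (not_lt.2 hpos.le), decide_eq_false_iff_not, not_lt] at h
    rw [abs_of_pos hpos, abs_of_nonpos (by nlinarith)]
    nlinarith

/-! ### Chebyshev: few coin strings give a wrong vote -/

/-- **Counting the wrong votes.** If the round signs have block sum `4ⁿ μ` with `μ ≠ 0`, then among the coin
strings of length `2nN` (offset `0`) those whose vote disagrees with the sign of `μ` (the vote reads `+` iff
`μ < 0`) number at most `4^{nN} / (N μ²)`. [cite: AroraBarak2009, Lemma A.12 and §7.4.1] -/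
theorem cnt_voteN_wrong_mul_le {N n : ℕ} {cf cg : PCirc} {S : List Row} {μ : ℝ} (hμ : μ ≠ 0)
    (hsum : ∑ β : Fin (2 * n) → Bool, signOf (rbit n cf cg S (List.ofFn (hOf β)) (List.ofFn (wOf β))) =
      (2 : ℝ) ^ (2 * n) * μ) :
    (cnt (N * (2 * n)) {y | voteN N n cf cg S y 0 = decide (μ < 0)} : ℝ) * ((N : ℝ) * μ ^ 2) ≤
      (2 : ℝ) ^ (2 * n * N) := by
  classical
  set X : (Fin (2 * n) → Bool) → ℝ := fun β => signOf (rbit n cf cg S (List.ofFn (hOf β)) (List.ofFn (wOf β))) with hX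
  have hsq : ∑ β, X β ^ 2 ≤ (2 : ℝ) ^ (2 * n) * 1 := by rw [mul_one, hX, sum_signOf_rbit_blocks_sq]
  have hdev := card_deviation_mul_sq_le' (L := N) X μ 1 hsum hsq (N * |μ|) (by positivity)
  -- the wrong-vote strings, through the block bijection, are block tuples with a wrong sign
  have hset : {y : List Bool | voteN N n cf cg S y 0 = decide (μ < 0)} =
      {y | decide (0 < ∑ i, X (BravyiGosset.blocksOf (2 * n) y N i)) = decide (μ < 0)} := by
    ext y; simp only [Set.mem_setOf_eq]; rw [voteN_eq_decide]
  rw [hset, BravyiGosset.cnt_blocks (2 * n) N (fun ω => decide (0 < ∑ i, X (ω i)) = decide (μ < 0))]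
  -- … hence deviating block tuples
  have hsub : (univ.filter fun ω : Fin N → Fin (2 * n) → Bool => decide (0 < ∑ i, X (ω i)) = decide (μ < 0)) ⊆
      univ.filter fun ω : Fin N → Fin (2 * n) → Bool => (N : ℝ) * |μ| ≤ |∑ i, X (ω i) - N * μ| := by
    intro ω hω
    rw [mem_filter] at hω ⊢
    exact ⟨mem_univ _, mul_abs_le_abs_sub_of_wrong (Nat.cast_nonneg N) hμ hω.2⟩
  have hcard : ((univ.filter fun ω : Fin N → Fin (2 * n) → Bool =>
      decide (0 < ∑ i, X (ω i)) = decide (μ < 0)).card : ℝ) ≤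
      ((univ.filter fun ω : Fin N → Fin (2 * n) → Bool => (N : ℝ) * |μ| ≤ |∑ i, X (ω i) - N * μ|).card : ℝ) := by
    exact_mod_cast card_le_card hsub
  have habs : ((N : ℝ) * |μ|) ^ 2 = N * (N * μ ^ 2) := by rw [mul_pow, sq_abs]; ring
  rw [habs, mul_one] at hdev
  rcases Nat.eq_zero_or_pos N with rfl | hN
  · simp
  · have hNpos : (0 : ℝ) < N := by exact_mod_cast hN
    have h1 : ((univ.filter fun ω : Fin N → Fin (2 * n) → Bool =>
        decide (0 < ∑ i, X (ω i)) = decide (μ < 0)).card : ℝ) * (N * (N * μ ^ 2)) ≤ N * 2 ^ (2 * n * N) :=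
      le_trans (mul_le_mul_of_nonneg_right hcard (by positivity)) hdev
    have h2 : (N : ℝ) * (((univ.filter fun ω : Fin N → Fin (2 * n) → Bool =>
        decide (0 < ∑ i, X (ω i)) = decide (μ < 0)).card : ℝ) * (N * μ ^ 2)) ≤ N * 2 ^ (2 * n * N) := by
      calc _ = ((univ.filter fun ω : Fin N → Fin (2 * n) → Bool =>
            decide (0 < ∑ i, X (ω i)) = decide (μ < 0)).card : ℝ) * (N * (N * μ ^ 2)) := by ring
        _ ≤ _ := h1
    exact le_of_mul_le_mul_left h2 hNpos

/-! ### The relaxed rank certificate makes the mean large -/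

/-- `2ⁿ ≤ 4^p (n+2)^{c'}` under the relaxed rank certificate `n ≤ 2p + c' ⌊log₂(n+2)⌋`. [folklore] -/
theorem two_pow_le_of_rank {p c' : ℕ} (hrank : n ≤ 2 * p + c' * Nat.log 2 (n + 2)) :
    (2 : ℝ) ^ n ≤ 4 ^ p * (n + 2 : ℝ) ^ c' := by
  have h1 : (2 : ℝ) ^ n ≤ 2 ^ (2 * p + c' * Nat.log 2 (n + 2)) := pow_le_pow_right₀ (by norm_num) hrank
  have h2 : (2 : ℝ) ^ (2 * p + c' * Nat.log 2 (n + 2)) = 4 ^ p * ((2 : ℝ) ^ Nat.log 2 (n + 2)) ^ c' := by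
    rw [pow_add, pow_mul, mul_comm c', pow_mul]; norm_num
  have h3 : (2 : ℝ) ^ Nat.log 2 (n + 2) ≤ n + 2 := by exact_mod_cast Nat.pow_log_le_self 2 (by omega : n + 2 ≠ 0)
  rw [h2] at h1
  exact h1.trans (mul_le_mul_of_nonneg_left (pow_le_pow_left₀ (by positivity) h3 c') (by positivity))

/-- **The relaxed machine has enough rounds**: with `p = #pivs` certified by `n ≤ 2p + c' ⌊log₂(n+2)⌋` and
`|Φ| ≥ 3/5`, the mean `μ = 2^p √(2^{3n}) Φ / 4ⁿ` of a round has `roundsR c' n · μ² ≥ 72`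
(`μ² = Φ² 4^p / 2ⁿ ≥ Φ² / (n+2)^{c'}` and `roundsR = 200 (n+2)^{c'}`). [cite: AroraBarak2009, §7.4.1] -/
theorem seventytwo_le {p c' : ℕ} {Φ : ℝ} (hrank : n ≤ 2 * p + c' * Nat.log 2 (n + 2)) (hΦ : 3 / 5 ≤ |Φ|) :
    (72 : ℝ) ≤ roundsR c' n * ((2 : ℝ) ^ p * (Real.sqrt (2 ^ (3 * n)) * Φ) / 2 ^ (2 * n)) ^ 2 := by
  have hsq : ((2 : ℝ) ^ p * (Real.sqrt (2 ^ (3 * n)) * Φ) / 2 ^ (2 * n)) ^ 2 = Φ ^ 2 * 4 ^ p / 2 ^ n := by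
    rw [div_pow, mul_pow, mul_pow, Real.sq_sqrt (by positivity)]
    have h4 : ((2 : ℝ) ^ p) ^ 2 = 4 ^ p := by rw [← pow_mul, mul_comm, pow_mul]; norm_num
    rw [h4]
    field_simp
    ring
  rw [hsq, roundsR]
  push_cast
  have h2n : (0 : ℝ) < 2 ^ n := by positivity
  rw [← mul_div_assoc, le_div_iff₀ h2n]
  have hΦ2 : (9 / 25 : ℝ) ≤ Φ ^ 2 := by
    have := sq_abs Φ
    nlinarith [abs_nonneg Φ]
  have hr := two_pow_le_of_rank (n := n) hrank
  have h0 : (0 : ℝ) ≤ 4 ^ p * (n + 2 : ℝ) ^ c' - 2 ^ n := sub_nonneg.2 hr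
  nlinarith [mul_nonneg h0 (show (0:ℝ) ≤ Φ ^ 2 by positivity), mul_nonneg (sub_nonneg.2 hΦ2) (show (0:ℝ) ≤ 4 ^ p * (n + 2 : ℝ) ^ c' by positivity)]

section OneRun

variable {cf cg : PCirc} {f g : (Fin n → Bool) → Bool} {L : List (List Bool)}
  (hf : ∀ v, evalP cf v = f (toInput n v)) (hg : ∀ v, evalP cg v = g (toInput n v))
  (hM : ∀ u ∈ spanV n L, ∀ v ∈ spanV n L, ∀ y,
    (g y ^^ g (bxor y u) ^^ g (bxor y v) ^^ g (bxor y (bxor u v))) = false)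
  (hdual : ∑ z : Fin n → Bool, ∑ x ∈ matchSet g (spanV n L) z, signOf (f x) * signOf (g z) * twist x z =
    Real.sqrt (2 ^ (3 * n)) * forrelation f g)

include hf hg hM hdual in
/-- **SAFE law for one certified run.** If `g` is affine on the cosets of `spanV n L`, the dual-value identity
holds for `(f, g, spanV n L)`, the rows pass the relaxed rank certificate and `|Φ(f,g)| ≥ 3/5`, then at most
a `1/72` fraction of the coin strings of length `2n · roundsR c' n` make the vote of the relaxed machine
(offset `0`) disagree with the sign of `Φ(f,g)`. [cite: AroraBarak2009, Lemma A.12 and §7.4.1] -/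
theorem cnt_voteN_wrong_le {c' : ℕ} (hrank : n ≤ 2 * (pivs n (rrun n L)).card + c' * Nat.log 2 (n + 2))
    (hΦ : 3 / 5 ≤ |forrelation f g|) :
    72 * (cnt (roundsR c' n * (2 * n))
        {y | voteN (roundsR c' n) n cf cg (rrun n L) y 0 = decide (forrelation f g < 0)} : ℝ) ≤
      (2 : ℝ) ^ (2 * n * roundsR c' n) := by
  set μ : ℝ := (2 : ℝ) ^ (pivs n (rrun n L)).card * (Real.sqrt (2 ^ (3 * n)) * forrelation f g) / 2 ^ (2 * n) with hμ
  have hΦ0 : forrelation f g ≠ 0 := fun h => by rw [h, abs_zero] at hΦ; norm_num at hΦ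
  have hc : (0 : ℝ) < (2 : ℝ) ^ (pivs n (rrun n L)).card * Real.sqrt (2 ^ (3 * n)) / 2 ^ (2 * n) := by positivity
  have hμΦ : μ = ((2 : ℝ) ^ (pivs n (rrun n L)).card * Real.sqrt (2 ^ (3 * n)) / 2 ^ (2 * n)) * forrelation f g := by
    rw [hμ]; ring
  have hμ0 : μ ≠ 0 := by rw [hμΦ]; exact mul_ne_zero hc.ne' hΦ0
  have hsign : decide (forrelation f g < 0) = decide (μ < 0) := by
    rw [hμΦ]
    by_cases h : forrelation f g < 0
    · rw [decide_eq_true h, decide_eq_true (mul_neg_of_pos_of_neg hc h)]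
    · rw [decide_eq_false h, decide_eq_false (not_lt.2 (mul_nonneg hc.le (not_lt.1 h)))]
  have hsum : ∑ β : Fin (2 * n) → Bool, signOf (rbit n cf cg (rrun n L) (List.ofFn (hOf β)) (List.ofFn (wOf β))) =
      (2 : ℝ) ^ (2 * n) * μ := by
    rw [sum_signOf_rbit_blocks hf hg hM, hdual, hμ, mul_div_cancel₀ _ (by positivity)]
  have h72 := seventytwo_le (n := n) hrank hΦ
  rw [← hμ] at h72
  have hmain := cnt_voteN_wrong_mul_le (N := roundsR c' n) hμ0 hsum
  rw [hsign]
  have hcnt : (0 : ℝ) ≤ (cnt (roundsR c' n * (2 * n)) {y | voteN (roundsR c' n) n cf cg (rrun n L) y 0 = decide (μ < 0)} : ℝ) :=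
    Nat.cast_nonneg _
  nlinarith [mul_le_mul_of_nonneg_left h72 hcnt]

end OneRun

/-! ### Coin bookkeeping of the vote -/

/-- The rounds at offset `0` read only the first `2nN` coins. [folklore] -/
theorem negCountN_append (N n : ℕ) (cf cg : PCirc) (S : List Row) (y z : List Bool) (hy : N * (2 * n) ≤ y.length) :
    negCountN N n cf cg S (y ++ z) 0 = negCountN N n cf cg S y 0 := by
  unfold negCountN
  congr 1
  refine List.filter_congr fun r hr => ?_
  rw [List.mem_range] at hr
  have h1 : 0 + 2 * r * n + n ≤ y.length := by nlinarith
  have h2 : 0 + (2 * r + 1) * n + n ≤ y.length := by nlinarith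
  rw [coinVec_append y z h1, coinVec_append y z h2]

/-- Hence the vote at offset `0` reads only the first `2nN` coins. [folklore] -/
theorem voteN_append (N n : ℕ) (cf cg : PCirc) (S : List Row) (y z : List Bool) (hy : N * (2 * n) ≤ y.length) :
    voteN N n cf cg S (y ++ z) 0 = voteN N n cf cg S y 0 := by
  rw [voteN, voteN, negCountN_append N n cf cg S y z hy]

/-- A coin slice after a prefix `u`, read at offset `|u| + off`, is the slice of the rest at `off`. [folklore] -/
theorem coinVec_shift (u y : List Bool) (m off : ℕ) : coinVec (u ++ y) m (u.length + off) = coinVec y m off := by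
  unfold coinVec
  refine List.map_congr_left fun i _ => ?_
  rw [show u.length + off + i = u.length + (off + i) by ring, List.getD_append_right _ _ _ _ (by omega),
    Nat.add_sub_cancel_left]

/-- The rounds at offset `|u|` of `u ++ y` are the rounds at offset `0` of `y`. [folklore] -/
theorem negCountN_shift (N n : ℕ) (cf cg : PCirc) (S : List Row) (u y : List Bool) :
    negCountN N n cf cg S (u ++ y) u.length = negCountN N n cf cg S y 0 := by
  unfold negCountN
  congr 1
  refine List.filter_congr fun r _ => ?_
  rw [coinVec_shift, coinVec_shift, zero_add, zero_add]

/-- Hence the vote at offset `|u|` of `u ++ y` is the vote at offset `0` of `y`. [folklore] -/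
theorem voteN_shift (N n : ℕ) (cf cg : PCirc) (S : List Row) (u y : List Bool) :
    voteN N n cf cg S (u ++ y) u.length = voteN N n cf cg S y 0 := by
  rw [voteN, voteN, negCountN_shift]

end MMReadout

end Literature.Computability.QuantumComplexity

end
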